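import Summits.AnomalousDissipation.AnomalousDissipation.Theorems.ImpulseGridGridSignsLawStubWakeEnergyFloor
import Summits.AnomalousDissipation.AnomalousDissipation.Theorems.ImpulseGridGridThesisStubAcdcStrainBound
import Summits.AnomalousDissipation.AnomalousDissipation.Theorems.ImpulseGridGridThesisStubAcdcDesignCalculus
import Summits.AnomalousDissipation.AnomalousDissipation.Theorems.ImpulseGridGridThesisStubAcdcDesignIntegrals

/-!
# Line `Sketch` for crux `GridSignsLaw` (item stmt-AnomalousDissipation-14349, route ImpulseGrid) —
stub `stub_acdcWakeEnergyFloorExplicit`: the explicit wake-energy floor of the AC/DC grid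

Companion analysis stub (wave 2) of the line `Sketch` of the crux
`Summit.AnomalousDissipation.AnomalousDissipation.Theses.ImpulseGrid.GridSignsLaw`. For the explicit
AC/DC design — slab profile `Φ = 1 + 2θ cos 2πx₀` and cellular two-mode Stokes pattern
`G = A [sin 2πm(x₁+x₂) (e₁−e₂) + sin 2πm(x₁−x₂) (e₁+e₂)]`, `m ≥ 1`, `A, θ > 0` — every constant
`c` and every global Leray–Hopf solution `u` of the Navier–Stokes equations forced by `Φ•G` with a
sup-energy bound satisfy, in every generalized long-time limit `Λ`,

`∫‖G‖² − 8π²m²ν·Λ⟨(u, G)⟩ ≤ 4πmA·Λ⟨‖u − c e₀‖₂²⟩`.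

Proof. The general floor `stub_wakeEnergyFloor` (file `ImpulseGridGridSignsLawStubWakeEnergyFloor`)
reads `∫Φ‖G‖² + νΛ⟨(u, ΔG)⟩ ≤ σ·Λ⟨‖u − c e₀‖₂²⟩` for every smooth `x₀`-invariant divergence-free
`G` with `G₀ ≡ 0` and strain bound `|⟪ξ,(ξ·∇)G⟫| ≤ σ‖ξ‖²`. For the AC/DC pattern the design clauses
are `stub_acdcDesignCalculus`, the strain constant is `σ = 4πmA` (`stub_acdcStrainBound`),
`ΔG = −8π²m² G` (`stub_acdcDesignCalculus`), so `Λ⟨(u, ΔG)⟩ = −8π²m² Λ⟨(u, G)⟩`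
(`GridInjection.longTimeAvg_const_mul`), and `∫Φ‖G‖² = (Φ•G, G) = ∫‖G‖²`
(`stub_acdcDesignIntegrals`: the slab modulation `2θ cos 2πx₀ ‖G‖²` integrates to zero).

References: Foias–Manley–Rosa–Temam 2001, Ch. IV §1.3, §3.1; Constantin–Foias 1988, Ch. 4
(4.13)–(4.14). No new definitions.
-/

noncomputable section

-- `Summit.<Summit>.<Problem>` is the tree's mandated summit-side namespace (CONVENTIONS §2); for this
-- single-conjunct summit the two coincide, so the duplicate is deliberate.
set_option linter.dupNamespace false

open MeasureTheory Set Filter Topology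
open scoped InnerProductSpace RealInnerProductSpace

namespace Summit.AnomalousDissipation.AnomalousDissipation.Theorems

open Literature.Analysis.FunctionSpaces Literature.Analysis.FunctionSpaces.Torus
open Literature.Analysis.FluidPDE Literature.Analysis.FluidPDE.Torus

local notation "𝕋³" => UnitAddTorus (Fin 3)
local notation "E³" => EuclideanSpace ℝ (Fin 3)

/-- **Stub `stub_acdcWakeEnergyFloorExplicit` of line `Sketch` (crux `GridSignsLaw`,
stmt-AnomalousDissipation-14349): the explicit wake-energy floor of the AC/DC grid.** For the
explicit design (`m ≥ 1`, `A, θ > 0`), any constant `c` and every global Leray–Hopf solution with a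
sup-energy bound: `∫‖G‖² − 8π²m²ν·Λ⟨(u,G)⟩ ≤ 4πmA·Λ⟨‖u − c e₀‖₂²⟩`, i.e. (with `∫‖G‖² = 2A²`)
`Λ⟨‖w‖²⟩ ≥ A/(2πm) − 2πmν Λ⟨(u,G)⟩/A`. It is `stub_wakeEnergyFloor` with the strain bound
`σ = 4πmA` (`stub_acdcStrainBound`), `ΔG = −8π²m²G` (`stub_acdcDesignCalculus`) and
`∫Φ‖G‖² = (Φ•G, G) = ∫‖G‖²` (`stub_acdcDesignIntegrals`). [folklore] -/
theorem stub_acdcWakeEnergyFloorExplicit :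
    ∀ (Λ : GeneralizedLimit) (ν c : ℝ) (m : ℕ) (A θ : ℝ) (Φ : 𝕋³ → ℝ) (G : 𝕋³ → E³)
      (u₀ : 𝕋³ → E³) (u : ℝ → 𝕋³ → E³),
      Φ = (fun x => 1 + 2 * θ * (UnitAddTorus.mFourier (Pi.single (0 : Fin 3) (1 : ℤ)) x).re) →
      G = (fun x => A • (stokesMode ![(0 : ℤ), (m : ℤ), (m : ℤ)]
            (EuclideanSpace.single (1 : Fin 3) (1 : ℝ) - EuclideanSpace.single (2 : Fin 3) (1 : ℝ)) false x +
          stokesMode ![(0 : ℤ), (m : ℤ), -(m : ℤ)]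
            (EuclideanSpace.single (1 : Fin 3) (1 : ℝ) + EuclideanSpace.single (2 : Fin 3) (1 : ℝ)) false x)) →
      1 ≤ m → 0 < A → 0 < θ → 0 < ν →
      IsGlobalLerayHopf ν (fun _ => fun x => Φ x • G x) u₀ u →
      (∃ K : ℝ, ∀ t : ℝ, 0 ≤ t → kineticEnergy (u t) ≤ K) →
      (∫ x, ‖G x‖ ^ 2) - 8 * Real.pi ^ 2 * (m : ℝ) ^ 2 * ν * Λ.longTimeAvg (fun t => ∫ x, ⟪u t x, G x⟫) ≤
        4 * Real.pi * (m : ℝ) * A *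
          Λ.longTimeAvg (fun t => ∫ x, ‖u t x - c • EuclideanSpace.single 0 1‖ ^ 2) := by
  intro Λ ν c m A θ Φ G u₀ u hΦ hG hm hA hθ hν hu hE
  -- the design clauses, with the sawtooth `Ψ = (θ/π) Im e₀` and the quadrature pair
  -- `C = (Re e₀) G`, `S = (Im e₀) G`
  obtain ⟨hΦs, -, hGs, -, hGinv, hG0, hGdiv, -, -, -, hΔG, -⟩ :=
    stub_acdcDesignCalculus m A θ Φ
      (fun x => θ / Real.pi * (UnitAddTorus.mFourier (Pi.single (0 : Fin 3) (1 : ℤ)) x).im) G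
      (fun x => (UnitAddTorus.mFourier (Pi.single (0 : Fin 3) (1 : ℤ)) x).re • G x)
      (fun x => (UnitAddTorus.mFourier (Pi.single (0 : Fin 3) (1 : ℤ)) x).im • G x)
      hΦ rfl hG rfl rfl hm hA hθ
  obtain ⟨-, -, -, -, hFG, -⟩ :=
    stub_acdcDesignIntegrals m A θ Φ
      (fun x => θ / Real.pi * (UnitAddTorus.mFourier (Pi.single (0 : Fin 3) (1 : ℤ)) x).im) G
      (fun x => (UnitAddTorus.mFourier (Pi.single (0 : Fin 3) (1 : ℤ)) x).re • G x)
      (fun x => (UnitAddTorus.mFourier (Pi.single (0 : Fin 3) (1 : ℤ)) x).im • G x)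
      hΦ rfl hG rfl rfl hm hA hθ
  -- the strain bound `σ = 4πmA` and the general floor
  have hstrain := stub_acdcStrainBound m A G hG hA
  have hfloor := stub_wakeEnergyFloor Λ ν c (4 * Real.pi * (m : ℝ) * A) Φ G u₀ u hν hΦs hGs hGinv
    hG0 hGdiv hstrain hu hE
  -- (i) `∫Φ‖G‖² = (Φ•G, G) = ∫‖G‖²`
  have h1 : ∫ x, Φ x * ‖G x‖ ^ 2 = ∫ x, ‖G x‖ ^ 2 := by
    rw [← hFG]
    refine integral_congr_ae (ae_of_all _ fun x => ?_)
    simp only [real_inner_smul_left, real_inner_self_eq_norm_sq]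
  -- (ii) `Λ⟨(u, ΔG)⟩ = -8π²m² Λ⟨(u, G)⟩`
  have h2 : Λ.longTimeAvg (fun t => ∫ x, ⟪u t x, laplacian G x⟫) =
      -(8 * Real.pi ^ 2 * (m : ℝ) ^ 2) * Λ.longTimeAvg (fun t => ∫ x, ⟪u t x, G x⟫) := by
    rw [← GridInjection.longTimeAvg_const_mul]
    congr 1
    funext t
    rw [← integral_const_mul]
    refine integral_congr_ae (ae_of_all _ fun x => ?_)
    show ⟪u t x, laplacian G x⟫ = -(8 * Real.pi ^ 2 * (m : ℝ) ^ 2) * ⟪u t x, G x⟫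
    rw [hΔG x, inner_neg_right, real_inner_smul_right, neg_mul]
  rw [h1, h2] at hfloor
  linarith

end Summit.AnomalousDissipation.AnomalousDissipation.Theorems

end
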